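import Summits.RiemannHypothesis.RiemannHypothesis.Theorems.ScrewLemmaKExtremalRayDefs
import Summits.RiemannHypothesis.RiemannHypothesis.Theorems.ScrewLemmaKCoprofileDensityApprox
import HarnessLib

/-!
# Route `ScrewLemmaKExtremalRay`, crux E1 (`NearExtremalGenerators`, stmt-RiemannHypothesis-22262):
# the dilation operator is bounded on `L²(0,1)`

For the DILATION (lattice-averaging) operator `(Aψ)(t) = Σ_{n ≤ 1/t} ψ(nt)/n`
(`ScrewLemmaKExtremalRay.coprofileOp`; the lattice co-profile of the SCREW column is `Φ_g = A g′`)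
and every measurable `ψ` with `ψ² ∈ L¹(0,1)`:

  `∫₀¹ (Aψ)(t)² dt ≤ 9 · ∫₀¹ ψ(u)² du`,   and `(Aψ)² ∈ L¹(0,1)`.

(The sharp constant is `ζ(3/2)² = (Σ n^{-3/2})² ≈ 6.82`; we prove `Σ_{n ≤ N} n^{-3/2} ≤ 3`.)
Proof: for the truncations `A_N ψ(t) = Σ_{n ≤ min(N, 1/t)} ψ(nt)/n`, the weighted Cauchy–Schwarz
inequality `(Σ ψ(nt)/n)² ≤ (Σ n^{-3/2}) · (Σ n^{-1/2} ψ(nt)²)`, the substitution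
`∫₀^{1/n} ψ(nt)² dt = n^{-1} ∫₀¹ ψ²` (Mathlib `Measure.integral_comp_mul_left`) and
`Σ n^{-3/2} ≤ 3` give `∫₀¹ (A_N ψ)² ≤ 9 ∫₀¹ ψ²` for every `N`; since `A_N ψ(t) = Aψ(t)` as soon as
`N ≥ 1/t`, Fatou's lemma passes to the limit.  This is the `L²`-continuity of `φ ↦ Aφ` that the
near-extremal construction of E1 (Möbius generator, smoothing, correction) needs.  RH-free real
analysis; nothing here bears on the truth of RH.

Main results: `integral_sq_coprofileOp_le` (the bound, with integrability; interface forms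
`integrableOn_coprofileOp_sq`, `integral_coprofileOp_sq_le` as agreed with the E1 closer seat),
`integral_sq_le_of_tendsto` (the Fatou-type lemma used, reusable), `measurable_coprofileOp`.
Builds on `ScrewLemmaKExtremalRayDefs` (k1-w3) and reuses
`ScrewLemmaKCoprofile.ae_forall_nat_mul_ne_one` (DensityApprox).
-/

set_option linter.dupNamespace false

noncomputable section

namespace Summit.RiemannHypothesis.RiemannHypothesis.Theorems.ScrewLemmaKExtremalRay

open MeasureTheory Set Filter
open Summit.RiemannHypothesis.RiemannHypothesis.Theorems.ScrewLemmaKCoprofile (ae_forall_nat_mul_ne_one)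

/-! ### The numerical constant: `Σ_{n=1}^{N} 1/(n√n) ≤ 3` -/

/-- One telescoping step: `1/((N+1)√(N+1)) ≤ 2/√N − 2/√(N+1)` for `N ≥ 1`. [folklore] -/
theorem inv_mul_sqrt_le_telescope {N : ℕ} (hN : 1 ≤ N) :
    1 / (((N:ℝ) + 1) * Real.sqrt ((N:ℝ) + 1)) ≤ 2 / Real.sqrt N - 2 / Real.sqrt ((N:ℝ) + 1) := by
  have hN' : (1:ℝ) ≤ N := by exact_mod_cast hN
  set a := Real.sqrt (N:ℝ) with ha
  set b := Real.sqrt ((N:ℝ) + 1) with hb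
  have ha0 : 0 < a := Real.sqrt_pos.mpr (by linarith)
  have hb0 : 0 < b := Real.sqrt_pos.mpr (by linarith)
  have ha2 : a ^ 2 = N := by rw [ha, Real.sq_sqrt (by linarith)]
  have hb2 : b ^ 2 = (N:ℝ) + 1 := by rw [hb, Real.sq_sqrt (by linarith)]
  -- the polynomial heart: `a(2a²+3) ≤ 2b(a²+1)`, by squaring (`x(2x+3)² ≤ 4(x+1)³`)
  have key : a * (2 * a ^ 2 + 3) ≤ 2 * b * (a ^ 2 + 1) := by
    have h1 : 0 ≤ a * (2 * a ^ 2 + 3) := by positivity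
    have h2 : 0 ≤ 2 * b * (a ^ 2 + 1) := by positivity
    rw [← pow_le_pow_iff_left₀ h1 h2 two_ne_zero]
    have e1 : (a * (2 * a ^ 2 + 3)) ^ 2 = (N:ℝ) * (2 * N + 3) ^ 2 := by
      rw [mul_pow, ha2]
    have e2 : (2 * b * (a ^ 2 + 1)) ^ 2 = 4 * ((N:ℝ) + 1) ^ 3 := by
      rw [ha2, mul_pow, mul_pow, hb2]; ring
    rw [e1, e2]
    nlinarith
  have hb3 : ((N:ℝ) + 1) * b = b ^ 3 := by rw [← hb2]; ring
  rw [hb3, div_sub_div _ _ ha0.ne' hb0.ne', div_le_div_iff₀ (by positivity) (by positivity)]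
  -- goal: 1 * (a * b) ≤ (2 * b - a * 2) * b ^ 3   [after cross-multiplication]
  have hb3' : b ^ 3 = b * (a ^ 2 + 1) := by rw [ha2, ← hb2]; ring
  nlinarith [key, hb3', ha0, hb0, mul_pos ha0 hb0]

/-- `Σ_{n=1}^{N} 1/(n√n) ≤ 3 − 2/√N` for `N ≥ 1` (telescoping). [folklore] -/
theorem sum_inv_mul_sqrt_le_sub {N : ℕ} (hN : 1 ≤ N) :
    ∑ n ∈ Finset.Icc 1 N, 1 / ((n:ℝ) * Real.sqrt n) ≤ 3 - 2 / Real.sqrt N := by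
  induction N, hN using Nat.le_induction with
  | base => simp; norm_num
  | succ N hN ih =>
    rw [Finset.sum_Icc_succ_top (by omega), Nat.cast_succ]
    have h := inv_mul_sqrt_le_telescope hN
    linarith

/-- `Σ_{n=1}^{N} 1/(n√n) ≤ 3` for every `N`. [folklore] -/
theorem sum_inv_mul_sqrt_le_three (N : ℕ) :
    ∑ n ∈ Finset.Icc 1 N, 1 / ((n:ℝ) * Real.sqrt n) ≤ 3 := by
  rcases Nat.eq_zero_or_pos N with h | h
  · subst h; simp
  · have h2 : 0 ≤ 2 / Real.sqrt N := by positivity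
    linarith [sum_inv_mul_sqrt_le_sub h]

/-! ### Measurability (the null set `{1/n}` is `ScrewLemmaKCoprofile.ae_forall_nat_mul_ne_one`) -/

/-- `t ↦ Σ_{n ≤ min N ⌊1/t⌋} ψ(nt)/n` is measurable for measurable `ψ` (`N = ⊤` allowed via
`min`-free form below). [folklore] -/
theorem measurable_truncSum {ψ : ℝ → ℝ} (hψ : Measurable ψ) (N : ℕ) :
    Measurable fun t : ℝ => ∑ n ∈ Finset.Icc 1 (min N ⌊1 / t⌋₊), ψ (n * t) / n := by
  have hP : Measurable fun p : ℝ × ℕ => ∑ n ∈ Finset.Icc 1 (min N p.2), ψ (n * p.1) / n :=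
    measurable_from_prod_countable_left fun M => by
      show Measurable fun x : ℝ => ∑ n ∈ Finset.Icc 1 (min N M), ψ (n * x) / n
      refine Finset.measurable_sum _ fun n _ => ?_
      exact (hψ.comp (measurable_const.mul measurable_id)).div_const _
  have hN : Measurable fun t : ℝ => ⌊1 / t⌋₊ :=
    Nat.measurable_floor.comp (measurable_const.div measurable_id)
  exact hP.comp (measurable_id.prodMk hN)

/-- `Aψ` is measurable for measurable `ψ`. [folklore] -/
theorem measurable_coprofileOp {ψ : ℝ → ℝ} (hψ : Measurable ψ) : Measurable (coprofileOp ψ) := by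
  have hP : Measurable fun p : ℝ × ℕ => ∑ n ∈ Finset.Icc 1 p.2, ψ (n * p.1) / n :=
    measurable_from_prod_countable_left fun M => by
      show Measurable fun x : ℝ => ∑ n ∈ Finset.Icc 1 M, ψ (n * x) / n
      refine Finset.measurable_sum _ fun n _ => ?_
      exact (hψ.comp (measurable_const.mul measurable_id)).div_const _
  have hN : Measurable fun t : ℝ => ⌊1 / t⌋₊ :=
    Nat.measurable_floor.comp (measurable_const.div measurable_id)
  exact hP.comp (measurable_id.prodMk hN)

/-! ### A Fatou-type lemma for squares -/

/-- FATOU in the form used here and downstream: if `G_m → G` a.e., each `G_m² ∈ L¹` and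
eventually `∫ G_m² ≤ c`, then `G² ∈ L¹` and `∫ G² ≤ c`. [folklore] -/
theorem integral_sq_le_of_tendsto {μ : Measure ℝ} {G : ℕ → ℝ → ℝ} {Glim : ℝ → ℝ} {c : ℝ}
    (hc : 0 ≤ c) (hmeas : ∀ m, AEMeasurable (G m) μ)
    (hint : ∀ m, Integrable (fun y => (G m y) ^ 2) μ)
    (hbound : ∀ᶠ m in atTop, ∫ y, (G m y) ^ 2 ∂μ ≤ c)
    (hlim : ∀ᵐ y ∂μ, Tendsto (fun m => G m y) atTop (nhds (Glim y))) :
    Integrable (fun y => (Glim y) ^ 2) μ ∧ ∫ y, (Glim y) ^ 2 ∂μ ≤ c := by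
  have hGlim : AEMeasurable Glim μ := aemeasurable_of_tendsto_metrizable_ae' hmeas hlim
  have hsqm : AEMeasurable (fun y => (Glim y) ^ 2) μ := hGlim.pow_const 2
  have hF : ∫⁻ y, ENNReal.ofReal ((Glim y) ^ 2) ∂μ ≤ ENNReal.ofReal c := by
    have hcongr : (fun y => ENNReal.ofReal ((Glim y) ^ 2))
        =ᵐ[μ] fun y => liminf (fun m => ENNReal.ofReal ((G m y) ^ 2)) atTop := by
      filter_upwards [hlim] with y hy
      have ht : Tendsto (fun m => ENNReal.ofReal ((G m y) ^ 2)) atTop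
          (nhds (ENNReal.ofReal ((Glim y) ^ 2))) :=
        (ENNReal.continuous_ofReal.tendsto _).comp (hy.pow 2)
      exact ht.liminf_eq.symm
    rw [lintegral_congr_ae hcongr]
    refine le_trans (lintegral_liminf_le' fun m => ?_) ?_
    · exact ENNReal.measurable_ofReal.comp_aemeasurable ((hmeas m).pow_const 2)
    · refine liminf_le_of_frequently_le' ?_
      refine (hbound.mono fun m hm => ?_).frequently
      rw [← ofReal_integral_eq_lintegral_ofReal (hint m) (ae_of_all _ fun y => sq_nonneg _)]
      exact ENNReal.ofReal_le_ofReal hm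
  have hfin : HasFiniteIntegral (fun y => (Glim y) ^ 2) μ := by
    rw [hasFiniteIntegral_iff_ofReal (ae_of_all _ fun y => sq_nonneg _)]
    exact lt_of_le_of_lt hF ENNReal.ofReal_lt_top
  have hI : Integrable (fun y => (Glim y) ^ 2) μ := ⟨hsqm.aestronglyMeasurable, hfin⟩
  refine ⟨hI, ?_⟩
  rw [integral_eq_lintegral_of_nonneg_ae (ae_of_all _ fun y => sq_nonneg _)
    hsqm.aestronglyMeasurable]
  exact ENNReal.toReal_le_of_le_ofReal hc hF

/-! ### The truncated operator: pointwise Cauchy–Schwarz and the `L²` bound -/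

/-- Weighted Cauchy–Schwarz for a truncated dilation sum:
`(Σ_{n∈S} ψ(nt)/n)² ≤ (Σ_{n∈S} 1/(n√n)) · Σ_{n∈S} ψ(nt)²/√n`. [folklore] -/
theorem sq_sum_div_le (ψ : ℝ → ℝ) (S : Finset ℕ) (hS : ∀ n ∈ S, 1 ≤ n) (t : ℝ) :
    (∑ n ∈ S, ψ (n * t) / n) ^ 2
      ≤ (∑ n ∈ S, 1 / ((n:ℝ) * Real.sqrt n)) * ∑ n ∈ S, ψ (n * t) ^ 2 / Real.sqrt n := by
  refine Finset.sum_sq_le_sum_mul_sum_of_sq_le_mul S (fun n _ => by positivity)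
    (fun n _ => by positivity) fun n hn => ?_
  have hn1 : (1:ℝ) ≤ n := by exact_mod_cast hS n hn
  have hn0 : (0:ℝ) < n := by linarith
  have hs0 : 0 < Real.sqrt n := Real.sqrt_pos.mpr hn0
  have hss : Real.sqrt n * Real.sqrt n = n := Real.mul_self_sqrt hn0.le
  rw [div_pow, div_mul_div_comm, one_mul]
  have e : (n:ℝ) * Real.sqrt n * Real.sqrt n = (n:ℝ) ^ 2 := by rw [mul_assoc, hss, sq]
  rw [e]

/-- The `L²(0,1)` bound for the truncations, uniformly in `N`:
`∫₀¹ (A_N ψ)² ≤ 9 ∫₀¹ ψ²` and `(A_N ψ)² ∈ L¹(0,1)`, for measurable `ψ` with `ψ² ∈ L¹(0,1)`.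
[folklore] -/
theorem integral_sq_truncSum_le {ψ : ℝ → ℝ} (hψ : Measurable ψ)
    (hψ2 : IntegrableOn (fun u => ψ u ^ 2) (Set.Ioo (0:ℝ) 1)) (N : ℕ) :
    IntegrableOn (fun t => (∑ n ∈ Finset.Icc 1 (min N ⌊1 / t⌋₊), ψ (n * t) / n) ^ 2)
        (Set.Ioo (0:ℝ) 1) ∧
      (∫ t in Set.Ioo (0:ℝ) 1, (∑ n ∈ Finset.Icc 1 (min N ⌊1 / t⌋₊), ψ (n * t) / n) ^ 2)
        ≤ 9 * ∫ u in Set.Ioo (0:ℝ) 1, ψ u ^ 2 := by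
  -- the majorant `3 · Σ_{n ≤ N} G(nt)/√n`, `G = 1_{(0,1)} ψ²`
  set G : ℝ → ℝ := (Set.Ioo (0:ℝ) 1).indicator (fun u => ψ u ^ 2) with hGdef
  have hGint : Integrable G := by
    rw [hGdef, integrable_indicator_iff measurableSet_Ioo]; exact hψ2
  have hGn : ∀ n : ℕ, 1 ≤ n → Integrable (fun t : ℝ => G (n * t)) := fun n hn =>
    hGint.comp_mul_left' (Nat.cast_ne_zero.mpr (by omega))
  have hG0 : ∀ x, 0 ≤ G x := fun x => by
    rw [hGdef]; exact Set.indicator_nonneg (fun u _ => sq_nonneg _) _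
  have hGval : ∫ x, G x = ∫ u in Set.Ioo (0:ℝ) 1, ψ u ^ 2 := integral_indicator measurableSet_Ioo
  set M : ℝ → ℝ := fun t => 3 * ∑ n ∈ Finset.Icc 1 N, G (n * t) / Real.sqrt n with hMdef
  have hMint : Integrable M := by
    refine Integrable.const_mul (integrable_finsetSum _ fun n hn => ?_) 3
    rw [Finset.mem_Icc] at hn
    exact (hGn n hn.1).div_const _
  -- pointwise domination off the null set `{1/n}`
  have hdom : ∀ t ∈ Set.Ioo (0:ℝ) 1, (∀ n : ℕ, (n:ℝ) * t ≠ 1) →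
      (∑ n ∈ Finset.Icc 1 (min N ⌊1 / t⌋₊), ψ (n * t) / n) ^ 2 ≤ M t := by
    intro t ht hne
    set S := Finset.Icc 1 (min N ⌊1 / t⌋₊) with hSdef
    have hS1 : ∀ n ∈ S, 1 ≤ n := fun n hn => (Finset.mem_Icc.mp hn).1
    have h1 := sq_sum_div_le ψ S hS1 t
    have h2 : ∑ n ∈ S, 1 / ((n:ℝ) * Real.sqrt n) ≤ 3 :=
      le_trans (Finset.sum_le_sum_of_subset_of_nonneg
        (Finset.Icc_subset_Icc_right (min_le_left _ _)) fun n _ _ => by positivity)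
        (sum_inv_mul_sqrt_le_three N)
    have h3 : ∑ n ∈ S, ψ (n * t) ^ 2 / Real.sqrt n ≤ ∑ n ∈ Finset.Icc 1 N, G (n * t) / Real.sqrt n := by
      have hsub : S ⊆ Finset.Icc 1 N := Finset.Icc_subset_Icc_right (min_le_left _ _)
      have heq : ∀ n ∈ S, ψ (n * t) ^ 2 / Real.sqrt n = G (n * t) / Real.sqrt n := by
        intro n hn
        have hn' := Finset.mem_Icc.mp hn
        have hn1 : (1:ℝ) ≤ n := by exact_mod_cast hn'.1
        have hle : (n:ℝ) * t ≤ 1 := by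
          have h4 : (n:ℝ) ≤ ⌊1 / t⌋₊ := by exact_mod_cast le_trans hn'.2 (min_le_right _ _)
          have h5 : (⌊1 / t⌋₊ : ℝ) ≤ 1 / t := Nat.floor_le (one_div_nonneg.mpr ht.1.le)
          calc (n:ℝ) * t ≤ (1 / t) * t := mul_le_mul_of_nonneg_right (h4.trans h5) ht.1.le
            _ = 1 := one_div_mul_cancel ht.1.ne'
        have hmem : (n:ℝ) * t ∈ Set.Ioo (0:ℝ) 1 :=
          ⟨mul_pos (by linarith) ht.1, lt_of_le_of_ne hle (hne n)⟩
        rw [hGdef, Set.indicator_of_mem hmem]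
      rw [Finset.sum_congr rfl heq]
      exact Finset.sum_le_sum_of_subset_of_nonneg hsub fun n _ _ => by
        have := hG0 (n * t); positivity
    have h4 : 0 ≤ ∑ n ∈ S, ψ (n * t) ^ 2 / Real.sqrt n :=
      Finset.sum_nonneg fun n _ => by positivity
    calc (∑ n ∈ S, ψ (n * t) / n) ^ 2
        ≤ (∑ n ∈ S, 1 / ((n:ℝ) * Real.sqrt n)) * ∑ n ∈ S, ψ (n * t) ^ 2 / Real.sqrt n := h1
      _ ≤ 3 * ∑ n ∈ S, ψ (n * t) ^ 2 / Real.sqrt n := mul_le_mul_of_nonneg_right h2 h4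
      _ ≤ M t := by rw [hMdef]; exact mul_le_mul_of_nonneg_left h3 (by norm_num)
  have hdom_ae : ∀ᵐ t ∂(volume.restrict (Set.Ioo (0:ℝ) 1)),
      ‖(∑ n ∈ Finset.Icc 1 (min N ⌊1 / t⌋₊), ψ (n * t) / n) ^ 2‖ ≤ M t := by
    filter_upwards [ae_restrict_mem measurableSet_Ioo,
      ae_restrict_of_ae (s := Set.Ioo (0:ℝ) 1) ae_forall_nat_mul_ne_one] with t ht hne
    rw [Real.norm_eq_abs, abs_of_nonneg (sq_nonneg _)]
    exact hdom t ht hne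
  have hmeasN := measurable_truncSum hψ N
  have hint : IntegrableOn (fun t => (∑ n ∈ Finset.Icc 1 (min N ⌊1 / t⌋₊), ψ (n * t) / n) ^ 2)
      (Set.Ioo (0:ℝ) 1) :=
    Integrable.mono' hMint.integrableOn (hmeasN.pow_const 2).aestronglyMeasurable hdom_ae
  refine ⟨hint, ?_⟩
  -- integrate the majorant
  have hMval : ∫ t in Set.Ioo (0:ℝ) 1, M t ≤ 9 * ∫ u in Set.Ioo (0:ℝ) 1, ψ u ^ 2 := by
    have e1 : ∫ t in Set.Ioo (0:ℝ) 1, M t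
        = 3 * ∑ n ∈ Finset.Icc 1 N, ∫ t in Set.Ioo (0:ℝ) 1, G (n * t) / Real.sqrt n := by
      rw [hMdef, integral_const_mul, integral_finsetSum]
      intro n hn
      rw [Finset.mem_Icc] at hn
      exact ((hGn n hn.1).div_const _).integrableOn
    have e2 : ∀ n ∈ Finset.Icc 1 N,
        (∫ t in Set.Ioo (0:ℝ) 1, G (n * t) / Real.sqrt n)
          ≤ (1 / ((n:ℝ) * Real.sqrt n)) * ∫ u in Set.Ioo (0:ℝ) 1, ψ u ^ 2 := by
      intro n hn
      rw [Finset.mem_Icc] at hn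
      have hn1 : (1:ℝ) ≤ n := by exact_mod_cast hn.1
      have hn0 : (0:ℝ) < n := by linarith
      have h1 : (∫ t in Set.Ioo (0:ℝ) 1, G (n * t) / Real.sqrt n)
          ≤ ∫ t, G (n * t) / Real.sqrt n :=
        setIntegral_le_integral ((hGn n hn.1).div_const _)
          (ae_of_all _ fun t => by have := hG0 (n * t); positivity)
      have h2 : (∫ t, G (n * t) / Real.sqrt n) = (1 / Real.sqrt n) * ((1 / n) * ∫ x, G x) := by
        have h3 : (∫ t : ℝ, G ((n:ℝ) * t)) = |((n:ℝ))⁻¹| • ∫ x, G x :=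
          Measure.integral_comp_mul_left G (n:ℝ)
        rw [abs_of_pos (inv_pos.mpr hn0), smul_eq_mul] at h3
        simp_rw [div_eq_mul_inv]
        rw [integral_mul_const, h3]
        ring
      rw [h2, hGval] at h1
      calc (∫ t in Set.Ioo (0:ℝ) 1, G (n * t) / Real.sqrt n)
          ≤ (1 / Real.sqrt n) * ((1 / n) * ∫ u in Set.Ioo (0:ℝ) 1, ψ u ^ 2) := h1
        _ = (1 / ((n:ℝ) * Real.sqrt n)) * ∫ u in Set.Ioo (0:ℝ) 1, ψ u ^ 2 := by
            field_simp
    have hI0 : 0 ≤ ∫ u in Set.Ioo (0:ℝ) 1, ψ u ^ 2 :=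
      setIntegral_nonneg measurableSet_Ioo fun u _ => sq_nonneg _
    calc ∫ t in Set.Ioo (0:ℝ) 1, M t
        = 3 * ∑ n ∈ Finset.Icc 1 N, ∫ t in Set.Ioo (0:ℝ) 1, G (n * t) / Real.sqrt n := e1
      _ ≤ 3 * ∑ n ∈ Finset.Icc 1 N,
            (1 / ((n:ℝ) * Real.sqrt n)) * ∫ u in Set.Ioo (0:ℝ) 1, ψ u ^ 2 := by
          gcongr with n hn
          exact e2 n hn
      _ = 3 * (∑ n ∈ Finset.Icc 1 N, 1 / ((n:ℝ) * Real.sqrt n))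
            * ∫ u in Set.Ioo (0:ℝ) 1, ψ u ^ 2 := by rw [← Finset.sum_mul]; ring
      _ ≤ 3 * 3 * ∫ u in Set.Ioo (0:ℝ) 1, ψ u ^ 2 := by
          gcongr
          exact sum_inv_mul_sqrt_le_three N
      _ = 9 * ∫ u in Set.Ioo (0:ℝ) 1, ψ u ^ 2 := by ring
  calc (∫ t in Set.Ioo (0:ℝ) 1, (∑ n ∈ Finset.Icc 1 (min N ⌊1 / t⌋₊), ψ (n * t) / n) ^ 2)
      ≤ ∫ t in Set.Ioo (0:ℝ) 1, M t :=
        integral_mono_of_nonneg (ae_of_all _ fun t => sq_nonneg _) hMint.integrableOn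
          (hdom_ae.mono fun t ht => by
            rw [Real.norm_eq_abs, abs_of_nonneg (sq_nonneg _)] at ht; exact ht)
    _ ≤ 9 * ∫ u in Set.Ioo (0:ℝ) 1, ψ u ^ 2 := hMval

/-! ### The bound for `A` itself -/

/-- **The dilation operator is bounded on `L²(0,1)`**: for measurable `ψ` with `ψ² ∈ L¹(0,1)`,
`(Aψ)² ∈ L¹(0,1)` and `∫₀¹ (Aψ)² ≤ 9 ∫₀¹ ψ²` (`A = coprofileOp`; sharp constant `ζ(3/2)²`).
[folklore] -/
theorem integral_sq_coprofileOp_le {ψ : ℝ → ℝ} (hψ : Measurable ψ)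
    (hψ2 : IntegrableOn (fun u => ψ u ^ 2) (Set.Ioo (0:ℝ) 1)) :
    IntegrableOn (fun t => coprofileOp ψ t ^ 2) (Set.Ioo (0:ℝ) 1) ∧
      (∫ t in Set.Ioo (0:ℝ) 1, coprofileOp ψ t ^ 2) ≤ 9 * ∫ u in Set.Ioo (0:ℝ) 1, ψ u ^ 2 := by
  have hI0 : 0 ≤ ∫ u in Set.Ioo (0:ℝ) 1, ψ u ^ 2 :=
    setIntegral_nonneg measurableSet_Ioo fun u _ => sq_nonneg _
  refine integral_sq_le_of_tendsto (μ := volume.restrict (Set.Ioo (0:ℝ) 1))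
    (G := fun N t => ∑ n ∈ Finset.Icc 1 (min N ⌊1 / t⌋₊), ψ (n * t) / n)
    (Glim := coprofileOp ψ) (by positivity)
    (fun N => (measurable_truncSum hψ N).aemeasurable)
    (fun N => (integral_sq_truncSum_le hψ hψ2 N).1)
    (Eventually.of_forall fun N => (integral_sq_truncSum_le hψ hψ2 N).2)
    (ae_of_all _ fun t => ?_)
  -- eventually constant: `A_N ψ t = A ψ t` for `N ≥ ⌊1/t⌋`
  refine tendsto_const_nhds.congr' ?_
  filter_upwards [eventually_ge_atTop ⌊1 / t⌋₊] with N hN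
  show coprofileOp ψ t = ∑ n ∈ Finset.Icc 1 (min N ⌊1 / t⌋₊), ψ (n * t) / n
  unfold coprofileOp
  rw [min_eq_right hN]

/-- **Interface form (i)**: `(Aψ)² ∈ L¹(0,1)` for measurable `ψ` with `ψ² ∈ L¹(0,1)`. [folklore] -/
theorem integrableOn_coprofileOp_sq {ψ : ℝ → ℝ} (hψm : Measurable ψ)
    (hψ : IntegrableOn (fun u => ψ u ^ 2) (Set.Ioo (0:ℝ) 1)) :
    IntegrableOn (fun t => coprofileOp ψ t ^ 2) (Set.Ioo (0:ℝ) 1) :=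
  (integral_sq_coprofileOp_le hψm hψ).1

/-- **Interface form (ii)**: `∫₀¹ (Aψ)² ≤ 9 ∫₀¹ ψ²` for measurable `ψ` with `ψ² ∈ L¹(0,1)`.
[folklore] -/
theorem integral_coprofileOp_sq_le {ψ : ℝ → ℝ} (hψm : Measurable ψ)
    (hψ : IntegrableOn (fun u => ψ u ^ 2) (Set.Ioo (0:ℝ) 1)) :
    (∫ t in Set.Ioo (0:ℝ) 1, coprofileOp ψ t ^ 2) ≤ 9 * ∫ u in Set.Ioo (0:ℝ) 1, ψ u ^ 2 :=
  (integral_sq_coprofileOp_le hψm hψ).2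

/-- `Aψ ∈ L²(0,1)` for measurable `ψ` with `ψ² ∈ L¹(0,1)`. [folklore] -/
theorem memLp_two_coprofileOp {ψ : ℝ → ℝ} (hψ : Measurable ψ)
    (hψ2 : IntegrableOn (fun u => ψ u ^ 2) (Set.Ioo (0:ℝ) 1)) :
    MemLp (coprofileOp ψ) 2 (volume.restrict (Set.Ioo (0:ℝ) 1)) := by
  rw [memLp_two_iff_integrable_sq (measurable_coprofileOp hψ).aestronglyMeasurable]
  exact (integral_sq_coprofileOp_le hψ hψ2).1

/-- `L²`-continuity of `A`: `∫₀¹ (Aφ − Aψ)² ≤ 9 ∫₀¹ (φ − ψ)²` (and integrability), for measurable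
`φ, ψ` with `(φ − ψ)² ∈ L¹(0,1)`. [folklore] -/
theorem integral_sq_coprofileOp_sub_le {φ ψ : ℝ → ℝ} (hφ : Measurable φ) (hψ : Measurable ψ)
    (h2 : IntegrableOn (fun u => (φ u - ψ u) ^ 2) (Set.Ioo (0:ℝ) 1)) :
    IntegrableOn (fun t => (coprofileOp φ t - coprofileOp ψ t) ^ 2) (Set.Ioo (0:ℝ) 1) ∧
      (∫ t in Set.Ioo (0:ℝ) 1, (coprofileOp φ t - coprofileOp ψ t) ^ 2)
        ≤ 9 * ∫ u in Set.Ioo (0:ℝ) 1, (φ u - ψ u) ^ 2 := by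
  have h := integral_sq_coprofileOp_le (ψ := fun u => φ u - ψ u) (hφ.sub hψ) h2
  have e : (fun t => coprofileOp (fun u => φ u - ψ u) t ^ 2)
      = fun t => (coprofileOp φ t - coprofileOp ψ t) ^ 2 := by
    funext t; rw [coprofileOp_sub]
  rw [e] at h
  exact h

end Summit.RiemannHypothesis.RiemannHypothesis.Theorems.ScrewLemmaKExtremalRay

end
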